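import Summits.QuantumFields.YangMills.Theses.SteinGapBootstrap
import Summits.QuantumFields.YangMills.Theorems.SteinGapBootstrapGapGivesClusteringGStubPairFormSymm
import Summits.QuantumFields.YangMills.Theorems.SteinGapBootstrapGapGivesClusteringGStubPolarisationBound
import HarnessLib
import HarnessLib.Audit

/-!
# Skeleton (lead `ym-line-sgb-p1`, RESHAPED from the planner's BC3 `Lines/birth.lean`) — crux K2 `GapGivesClusteringG`
# (stmt-QuantumFields-22999) of route `SteinGapBootstrap` (rev 2)

NOT THE CLAY GAP (rung R2ξ′ `WeakCouplingRates.XiPow`, an upper bound on lattice gaps; no summit statement is touched).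

RESHAPE (cycle 1).  The birth skeleton had three stubs: `stub_rpAllTimes` (`0 ≤ rpCorr μ F t` for ALL `t`, all `β`),
`stub_pairFormSymm`, `stub_polarisationBound`.  The width seats landed the last two BY NAME
(`Theorems/SteinGapBootstrapGapGivesClusteringGStubPairFormSymm.lean`, p578136; `…StubPolarisationBound.lean`, p578345), and the
second file proves the STRONGER `abs_pairCorr_le_of_rpZero`, which consumes reflection positivity and symmetry AT TIME ZERO ONLY
(Cauchy–Schwarz for the time-zero form, gap hypothesis at the even time `2t`).  Hence `stub_rpAllTimes` (whose odd-time half needs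
link-plane RP / positivity of the transfer matrix) is replaced by the single weaker stub

* `stub_rpZero` — time-zero site-plane reflection positivity of EVERY torus-limit state at EVERY real `β`:
  `0 ≤ rpCorr μ F 0` for positive-time `F`.

STATUS of `stub_rpZero`: PROVED for `β ≥ 0` (lead, `Theorems/SteinGapBootstrapGapGivesClusteringG.lean`:
`rpCorr_zero_nonneg_of_mem_limitPoints`, from gauge-boot's `siteRP_zero_of_mem_infiniteVolumeLimitPoints`, limits along tori of either
parity; whence `gapGivesClusteringG_of_nonneg` = the crux with `0 ≤ β →` inserted).  OPEN — neither in the tree nor in print — for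
`β < 0`: on odd tori the antipodal plane of `x₀ ↦ -x₀` bisects links and its Osterwalder–Seiler crossing kernel `exp(β Re tr(A*B))` is
of positive type iff `β ≥ 0`, so finite-volume site RP is unavailable and no limit argument exists.  The crux as filed quantifies
over all real `β`; the route's Assembly uses it only at `β ≥ β₀ → ∞`.

Composition `GapGivesClusteringG_of_stubs` (sorry-free outside the stub): `abs_pairCorr_le_of_rpZero` + `pairForm_symm` (all `β`)
+ `stub_rpZero`.
-/

namespace Summit.QuantumFields.YangMills.Cruxes.GapGivesClusteringG.Polarisation

open MeasureTheory
open Summit.QuantumFields.YangMills.Theorems.WeakCouplingRates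
open Summit.QuantumFields.YangMills.Theorems.SteinGapBootstrap
open Literature.MathematicalPhysics.QuantumLattice
open Literature.MathematicalPhysics.QuantumFieldTheory

/-- STUB (the only one; M for `β ≥ 0` — DONE, `rpCorr_zero_nonneg_of_mem_limitPoints`; OPEN for `β < 0`) — time-zero site-plane
reflection positivity of every torus-limit state: the connected RP correlator at time `0` is non-negative.
[cite: OsterwalderSeiler1978, §2] [cite: SeilerLNP1982, Ch. 2] -/
theorem stub_rpZero :
    ∀ (G : Type) [Group G] [TopologicalSpace G] [IsTopologicalGroup G] [CompactSpace G], IsCompactSimpleLieGroup G →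
    letI : MeasurableSpace G := borel G; haveI : BorelSpace G := ⟨rfl⟩;
    ∀ r : LatticeRep G, ∀ β : ℝ, ∀ μ ∈ infiniteVolumeLimitPoints (d := 4) r.ρ β,
    ∀ F : LGConfig 4 G → ℝ, IsPosTimeObs F → 0 ≤ rpCorr μ F 0 := by
  sorry

/-- COMPOSITION (kernel-checked, no `sorry` outside `stub_rpZero`): the crux `GapGivesClusteringG` BY NAME from `stub_rpZero`, the
landed `pairForm_symm` (θ- and translation invariance of limit states, every `β`) and the landed `abs_pairCorr_le_of_rpZero`
(Cauchy–Schwarz at time `0`, diagonal gap bound at time `2t`). -/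
theorem GapGivesClusteringG_of_stubs : Summit.QuantumFields.YangMills.Theses.SteinGapBootstrap.GapGivesClusteringG := by
  intro G _ _ _ _ hG r β μ hμ m hm A B hA hB a b ha hb t
  letI : MeasurableSpace G := borel G
  haveI : BorelSpace G := ⟨rfl⟩
  haveI : SecondCountableTopology G :=
    (r.continuous.isClosedEmbedding r.injective).isEmbedding.secondCountableTopology
  haveI : IsProbabilityMeasure μ := by obtain ⟨_, _, hprob, _⟩ := hμ; exact hprob
  refine abs_pairCorr_le_of_rpZero r.ρ hμ (fun F hF => stub_rpZero G hG r β μ hμ F hF)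
    (fun A' B' hA' hB' => ?_) hm hA hB ha hb t
  obtain ⟨SA, hAS, -⟩ := hA'.cyl
  obtain ⟨SB, hBS, -⟩ := hB'.cyl
  have h := pairForm_symm r.ρ r.continuous hμ hAS hA'.cont hA'.bdd hBS hB'.cont hB'.bdd 0
  simpa only [timeShiftLG_zero] using h

end Summit.QuantumFields.YangMills.Cruxes.GapGivesClusteringG.Polarisation
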